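/-
Copyright (c) 2026. All rights reserved.
Released under Apache 2.0 license as described in the file LICENSE.
Authors: HodgeCM publication cell (pub-hodgecm), GR lane, seat GR-2 (`pub-hodgecm-own-hyp34`).
-/
import Literature.NumberTheory.GelbartRogawski1991.Prop311PrintedSymplecticRational
import Literature.NumberTheory.GelbartRogawski1991.Prop311PrintedSplittingDatum
import Literature.NumberTheory.GelbartRogawski1991.CompatibleSplittingInvariance
import HarnessLib

/-!
# [GelbartRogawski1991, Prop. 3.1.1]: TRANSPORT to the printed objects — a compatible splitting on the tree's matrix
# carriers (in a `Φ`-orthogonal `E`-frame) plus a model comparison for `Mp_𝐀(W)` yields the PRINTED conclusion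

Topic `NumberTheory/GelbartRogawski1991`; namespace `Literature.NumberTheory.GelbartRogawski1991.Prop311`.
Proved lemmas only; nothing of [GelbartRogawski1991] is asserted; `Prop311AsPrinted` is untouched.

This is the capstone of the frame files (`Prop311PrintedFrame`, `…UnitaryFrame`, `…UnitaryJunction`,
`…SymplecticFrame`, `…SymplecticRational`): the `(Sp, GA, ι, G(F), Sp_F(W))`-part of the statement-exact typing of
[GelbartRogawski1991, §3.1 Prop. 3.1.1 p. 455 L1–2] — "*The covering `π` splits over `G(𝐀)`. There exists a continuous
section `s : G(𝐀) → Mp_𝐀(W)` such that `s(G(F))` is contained in `i(Sp_F(W))`*" — is identified with the tree's matrix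
carriers, so that `SplittingDatum.CompatibleSplitting.transport_of_unique` (`CompatibleSplittingInvariance.lean`)
applies.  Precisely, for printed data `(F, E, σ, V, Φ)` (axioms of `Prop311AsPrinted`), a `Φ`-orthogonal `E`-basis `b`
with `Φ(bᵢ, bᵢ) = fᵢ δ` (`Prop311SkewHermitianOrthogonalBasis.exists_orthogonal_basis_imaginary`), `T = diag(-2 d fᵢ)`
invertible, a printed model `ρ` of `ρ_ψ` with its splitting `i` (binders `_hi`, `_hi!`), and ANY splitting datum `D` on
`(Sp(𝐀ᴺ × 𝐀ᴺ, alt (polar β_T)), Mp, U(T ⊗ 1)(𝔸_F))` whose `ι`, `G(F)`, `Sp_F(W)` are the tree's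
(`adelicToSymplectic`, `toAdelic (U(T⊗1)(F))`, `Weil1964.ratSp`) — e.g. the shape of `UnitaryDualPair.splittingDatum` —
together with a continuous homomorphism `φ : Mp → Mp_𝐀(W)_print` over `(frameSp b)⁻¹` (the `Mp` LEG, a comparison of
models of `ρ_ψ`, NOT provided here):

* §1 `mem_range_toAdelic_iff`, `rational_symplecticGram_eq`, **`frameUnitary'_mem_range_toAdelic_iff`** (`G(F)` matches),
  `isUnit_det_gramMatrix_of_orthogonal`, `continuous_frameUnitary'`;
* §2 **`printedDatum_ratSplit_unique`**: the binder `_hi!` in the datum form `huniq` of `transport_of_unique`;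
* §3 **`compatibleSplitting_printedDatum_of_frame`**: `D.CompatibleSplitting → (printedDatum F E V Φ ρ i hi).CompatibleSplitting`,
  and **`printed_conclusion_of_frame`**: the two printed clauses "(1) `π` splits over `G(𝐀)`; (2) there is a
  continuous section `s` with `s(G(F)) ⊆ i(Sp_F(W))`" in the verbatim rendering of `Prop311AsPrinted`.

So, once the `Mp` leg `φ` is supplied for the smooth model `Weil1964.adelicMpCont` (roadmap of `Prop311RhoPsiL2` /
`Prop311AdelicCoordinates`), `GRConstruction.gru_shape`-type theorems on matrix carriers yield the printed proposition
for the corresponding printed data.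

## References
* [GelbartRogawski1991] S. Gelbart, J. Rogawski, Invent. Math. 105 (1991) 445–472, §3.1 p. 454 L17–42, Prop. 3.1.1
  p. 455 L1–2.
* [MoeglinVignerasWaldspurger1987] C. Mœglin, M.-F. Vignéras, J.-L. Waldspurger, LNM 1291 (1987), Chap. 2 II.1 (B).
-/

set_option autoImplicit false

noncomputable section

open NumberField
open scoped TensorProduct Matrix
open Literature.NumberTheory.Automorphic
open Literature.NumberTheory.Automorphic.UnitaryGroup
open Literature.RepresentationTheory.HeisenbergGroup

namespace Literature.NumberTheory.GelbartRogawski1991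

namespace Prop311

open QuadraticCoordinates

variable (F : Type) [Field F] [NumberField F]
variable (E : Type) [Field E] [NumberField E] [Algebra F E] [Algebra.IsQuadraticExtension F E]
variable (σ : E ≃ₐ[F] E) {δ : E} (hσδ : σ δ = -δ) (hδ : δ ≠ 0) {d : F} (hd : δ * δ = algebraMap F E d)
variable (V : Type) [AddCommGroup V] [Module F V] [Module E V] [IsScalarTower F E V]
variable {n : ℕ} (b : Module.Basis (Fin n) E V)
variable (Φ : V →ₗ[F] V →ₗ[F] E) (f : Fin n → F)

/-! ## §1. Rational points and continuity for `frameUnitary'` -/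

section Unitary

omit [NumberField F] [Algebra.IsQuadraticExtension F E] in
/-- membership in the range of the tree's diagonal embedding `toAdelic : U(J)(F) →* U(J)(𝔸_F)`, on underlying matrices.
[cite: Mok2014, §1 Notation p. 5] -/
theorem mem_range_toAdelic_iff (J : Matrix (Fin n) (Fin n) E) (x : UnitaryGroup.adelic F E σ n J) :
    x ∈ (UnitaryGroup.toAdelic F E σ n J).range ↔
      ∃ γ : GL (Fin n) E, γ ∈ UnitaryGroup.rational F E σ n J ∧
        (γ : Matrix (Fin n) (Fin n) E).map (algebraMap E (AdeleRing (𝓞 E) E)) =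
          ((x : GL (Fin n) (AdeleRing (𝓞 E) E)) : Matrix (Fin n) (Fin n) (AdeleRing (𝓞 E) E)) := by
  constructor
  · rintro ⟨γ, rfl⟩
    exact ⟨γ, γ.2, rfl⟩
  · rintro ⟨γ, hγ, h⟩
    exact ⟨⟨γ, hγ⟩, Subtype.ext (Units.ext h)⟩

omit [NumberField F] [Algebra.IsQuadraticExtension F E] [IsScalarTower F E V] in
include hδ hd in
/-- `U(T ⊗ 1)(F) = U(gramMatrix b Φ)(F)` (unit scalar `-2δ`). [cite: GelbartRogawski1991, §3.1 p. 454 L37–42] -/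
theorem rational_symplecticGram_eq (hb : ∀ i j, i ≠ j → Φ (b i) (b j) = 0)
    (hf : ∀ i, Φ (b i) (b i) = algebraMap F E (f i) * δ) :
    UnitaryGroup.rational F E σ n ((symplecticGram F d f).map (algebraMap F E)) =
      UnitaryGroup.rational F E σ n (gramMatrix F E V b Φ) := by
  have h2δ : IsUnit (-2 * δ) := isUnit_iff_ne_zero.2 (mul_ne_zero (neg_ne_zero.2 two_ne_zero) hδ)
  unfold UnitaryGroup.rational
  rw [symplecticGram_map_eq_smul_gramMatrix F E hd V b Φ f hb hf, unitaryGroupOfForm_smul _ _ h2δ]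

/-- **`G(F)` matches**: `frameUnitary' g ∈ toAdelic (U(T ⊗ 1)(F))` iff `IsRationalPoint g`.
[cite: GelbartRogawski1991, Prop. 3.1.1 p. 455 L2] -/
theorem frameUnitary'_mem_range_toAdelic_iff (hΦ₁ : ∀ (e : E) (x y : V), Φ (e • x) y = e * Φ x y)
    (hΦ₂ : ∀ (e : E) (x y : V), Φ x (e • y) = Φ x y * σ e) (hb : ∀ i j, i ≠ j → Φ (b i) (b j) = 0)
    (hf : ∀ i, Φ (b i) (b i) = algebraMap F E (f i) * δ) (g : adelicUnitary F E V Φ) :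
    frameUnitary' F E σ hσδ hδ hd V b Φ f hΦ₁ hΦ₂ hb hf g ∈
        (UnitaryGroup.toAdelic F E σ n ((symplecticGram F d f).map (algebraMap F E))).range ↔
      IsRationalPoint F E V Φ (g : AdelicSpace F V ≃ₗ[AdeleRing (𝓞 F) F] AdelicSpace F V) := by
  rw [← frameUnitary_mem_range_toAdelic_iff F E σ hσδ hδ hd V b Φ hΦ₁ hΦ₂, mem_range_toAdelic_iff,
    mem_range_toAdelic_iff, coe_frameUnitary', rational_symplecticGram_eq F E σ hδ hd V b Φ f hb hf]

omit [NumberField F] [NumberField E] [Algebra.IsQuadraticExtension F E] [IsScalarTower F E V] in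
include hδ in
/-- the Gram matrix of an orthogonal frame with all `fᵢ ≠ 0` is invertible. [cite: GelbartRogawski1991, §3.1 p. 454 L37–42] -/
theorem isUnit_det_gramMatrix_of_orthogonal (hb : ∀ i j, i ≠ j → Φ (b i) (b j) = 0)
    (hf : ∀ i, Φ (b i) (b i) = algebraMap F E (f i) * δ) (hf0 : ∀ i, f i ≠ 0) :
    IsUnit (gramMatrix F E V b Φ).det := by
  rw [gramMatrix_eq_of_orthogonal F E V b Φ f hb hf, Matrix.diagonal_map (map_zero _), Matrix.det_smul,
    Matrix.det_diagonal, isUnit_iff_ne_zero]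
  exact mul_ne_zero (pow_ne_zero _ hδ) (Finset.prod_ne_zero_iff.2 fun i _ => (map_ne_zero (algebraMap F E)).2 (hf0 i))

/-- **`frameUnitary' b : G(𝐀) → U(T ⊗ 1)(𝔸_F)` is continuous** (printed topology → unit-group topology).
[cite: GelbartRogawski1991, Prop. 3.1.1 p. 455 L1–2] -/
theorem continuous_frameUnitary' (hΦ₁ : ∀ (e : E) (x y : V), Φ (e • x) y = e * Φ x y)
    (hΦ₂ : ∀ (e : E) (x y : V), Φ x (e • y) = Φ x y * σ e) (hb : ∀ i j, i ≠ j → Φ (b i) (b j) = 0)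
    (hf : ∀ i, Φ (b i) (b i) = algebraMap F E (f i) * δ) (hJ : IsUnit (gramMatrix F E V b Φ).det) :
    Continuous (frameUnitary' F E σ hσδ hδ hd V b Φ f hΦ₁ hΦ₂ hb hf) := by
  refine continuous_induced_rng.2 ?_
  show Continuous fun g : adelicUnitary F E V Φ =>
    ((frameUnitary' F E σ hσδ hδ hd V b Φ f hΦ₁ hΦ₂ hb hf g :
      UnitaryGroup.adelic F E σ n ((symplecticGram F d f).map (algebraMap F E))) : GL (Fin n) (AdeleRing (𝓞 E) E))
  have hval : (fun g : adelicUnitary F E V Φ =>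
      ((frameUnitary' F E σ hσδ hδ hd V b Φ f hΦ₁ hΦ₂ hb hf g :
        UnitaryGroup.adelic F E σ n ((symplecticGram F d f).map (algebraMap F E))) : GL (Fin n) (AdeleRing (𝓞 E) E))) =
      fun g => ((frameUnitary F E σ hσδ hδ hd V b Φ hΦ₁ hΦ₂ g : UnitaryGroup.adelic F E σ n (gramMatrix F E V b Φ)) :
        GL (Fin n) (AdeleRing (𝓞 E) E)) :=
    funext fun g => coe_frameUnitary' F E σ hσδ hδ hd V b Φ f hΦ₁ hΦ₂ hb hf g
  rw [hval]
  exact continuous_subtype_val.comp (continuous_frameUnitary F E σ hσδ hδ hd V b Φ hΦ₁ hΦ₂ hJ)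

end Unitary

/-! ## §2. The binder `_hi!` as uniqueness of the printed datum's rational section -/

section Unique

variable {S : Type} [NormedAddCommGroup S] [InnerProductSpace ℂ S]
variable (ρ : Representation ℂ (AdelicHeisenberg F E V Φ) S)
variable (i : ratSp F E V Φ →* adelicMp F E V Φ ρ) (hi : IsRationalSplitting F E V Φ ρ i)

omit [NumberField E] [Algebra.IsQuadraticExtension F E] in
/-- **`huniq` for the printed datum**: if `i` is THE rational splitting (binder `_hi!` of `Prop311AsPrinted`), every
homomorphic section of `π` over `Sp_F(W) ⊆ Sp_𝐀(W)` equals the printed datum's `ratSplit`.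
[cite: GelbartRogawski1991, §3.1 p. 454 L35–36] -/
theorem printedDatum_ratSplit_unique
    (hi! : ∀ i' : ratSp F E V Φ →* adelicMp F E V Φ ρ, IsRationalSplitting F E V Φ ρ i' → i' = i)
    (j : (printedDatum F E V Φ ρ i hi).spRat →* adelicMp F E V Φ ρ)
    (hj : ∀ y : (printedDatum F E V Φ ρ i hi).spRat, (printedDatum F E V Φ ρ i hi).proj (j y) = (y : adelicSp F E V Φ)) :
    j = (printedDatum F E V Φ ρ i hi).ratSplit := by
  let i' : ratSp F E V Φ →* adelicMp F E V Φ ρ := j.comp (ratSpEquiv F E V Φ).toMonoidHom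
  have hi'apply : ∀ g₀, i' g₀ = j (ratSpEquiv F E V Φ g₀) := fun g₀ => rfl
  have hi' : IsRationalSplitting F E V Φ ρ i' := fun g₀ => by
    have h := hj (ratSpEquiv F E V Φ g₀)
    rw [printedDatum_proj] at h
    unfold projEnd
    rw [hi'apply, h, coe_ratSpEquiv, coe_coe_ratSpToAdelic]
  have heq := hi! i' hi'
  refine MonoidHom.ext fun y => ?_
  have hy := DFunLike.congr_fun heq ((ratSpEquiv F E V Φ).symm y)
  rw [hi'apply, MulEquiv.apply_symm_apply] at hy
  exact hy.trans (printedDatum_ratSplit_apply F E V Φ ρ i hi y).symm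

end Unique

/-! ## §3. The transport -/

section Transport

variable {S : Type} [NormedAddCommGroup S] [InnerProductSpace ℂ S]
variable (ρ : Representation ℂ (AdelicHeisenberg F E V Φ) S)
variable (i : ratSp F E V Φ →* adelicMp F E V Φ ρ) (hi : IsRationalSplitting F E V Φ ρ i)

/-- **TRANSPORT TO THE PRINTED DATUM.**  Let `b` be a `Φ`-orthogonal `E`-basis with `Φ(bᵢ, bᵢ) = fᵢ δ`, `fᵢ ≠ 0`,
`T = diag(-2 d fᵢ)`; let `D` be ANY splitting datum on carriers `(Sp(𝐀ᴺ × 𝐀ᴺ, alt (polar β_{T'})), Mp, U(J')(𝔸_F))` of the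
tree's shape, for ANY spellings `J' = T ⊗_F E`, `T' = T ⊗_F 𝐀` of the form matrices (e.g. the reindexed Kronecker
matrices of `UnitaryDualPair.splittingDatum`), with `ι = adelicToSymplectic` (pointwise, as automorphisms of `𝐀ᴺ × 𝐀ᴺ`),
`G(F) = toAdelic (U(J')(F))`, `Sp_F(W) = range (Weil1964.ratSp T')`, and let `φ : Mp → Mp_𝐀(W)` (printed pairs over `ρ`)
be a continuous homomorphism over `(frameSp b)⁻¹` (pointwise: `adelicFrame ∘ π'(φ m) ∘ adelicFrame⁻¹ = π(m)`).  If `i`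
is THE rational splitting (`_hi!`), a compatible splitting for `D` yields one for `printedDatum F E V Φ ρ i hi`.
[cite: GelbartRogawski1991, §3.1 p. 454 L17–42; Prop. 3.1.1 p. 455 L1–2] -/
theorem compatibleSplitting_printedDatum_of_frame
    (hΦ₁ : ∀ (e : E) (x y : V), Φ (e • x) y = e * Φ x y) (hΦ₂ : ∀ (e : E) (x y : V), Φ x (e • y) = Φ x y * σ e)
    (hb : ∀ i j, i ≠ j → Φ (b i) (b j) = 0) (hf : ∀ i, Φ (b i) (b i) = algebraMap F E (f i) * δ) (hf0 : ∀ i, f i ≠ 0)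
    (hi! : ∀ i' : ratSp F E V Φ →* adelicMp F E V Φ ρ, IsRationalSplitting F E V Φ ρ i' → i' = i)
    {J' : Matrix (Fin n) (Fin n) E} (hJ' : J' = (symplecticGram F d f).map (algebraMap F E))
    {T' : Matrix (Fin n) (Fin n) (AdeleRing (𝓞 F) F)}
    (hT'eq : T' = (symplecticGram F d f).map (algebraMap F (AdeleRing (𝓞 F) F))) (hT' : IsUnit T'.det)
    {Mp : Type*} [Group Mp] [TopologicalSpace Mp]
    (D : SplittingDatum (symplecticGroup (polar (Weil1964.adelicForm F (Fin n) T'))) Mp (UnitaryGroup.adelic F E σ n J'))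
    (hDtoSp : ∀ g : UnitaryGroup.adelic F E σ n J',
      ((D.toSp g : symplecticGroup (polar (Weil1964.adelicForm F (Fin n) T'))) :
          ((Fin n → AdeleRing (𝓞 F) F) × (Fin n → AdeleRing (𝓞 F) F)) ≃ₗ[AdeleRing (𝓞 F) F]
            ((Fin n → AdeleRing (𝓞 F) F) × (Fin n → AdeleRing (𝓞 F) F))) =
        (adelicToSymplectic F E σ n hσδ hδ hd (isSymm_symplecticGram F d f) hJ' g).1)
    (hDrat : D.ratPts = (UnitaryGroup.toAdelic F E σ n J').range)
    (hDsp : D.spRat = (Weil1964.ratSp F T' hT').range)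
    (φ : Mp →* adelicMp F E V Φ ρ) (hφ : Continuous φ)
    (hproj : ∀ m : Mp,
      frameConj F E σ hσδ hδ hd V b ((proj F E V Φ ρ (φ m) : adelicSp F E V Φ) :
          AdelicSpace F V ≃ₗ[AdeleRing (𝓞 F) F] AdelicSpace F V) =
        ((D.proj m : symplecticGroup (polar (Weil1964.adelicForm F (Fin n) T'))) :
          ((Fin n → AdeleRing (𝓞 F) F) × (Fin n → AdeleRing (𝓞 F) F)) ≃ₗ[AdeleRing (𝓞 F) F]
            ((Fin n → AdeleRing (𝓞 F) F) × (Fin n → AdeleRing (𝓞 F) F))))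
    (h : D.CompatibleSplitting) :
    (printedDatum F E V Φ ρ i hi).CompatibleSplitting := by
  subst hJ' hT'eq
  have hT : IsUnit (symplecticGram F d f).det := isUnit_det_symplecticGram F f (d_ne_zero F E hδ hd) hf0
  have hJ : IsUnit (gramMatrix F E V b Φ).det := isUnit_det_gramMatrix_of_orthogonal F E hδ V b Φ f hb hf hf0
  -- the isomorphism of the two `Sp_F(W)`, over `(frameSp b)⁻¹`
  let e₀ : D.spRat ≃* (printedDatum F E V Φ ρ i hi).spRat :=
    (MulEquiv.subgroupCongr hDsp).trans (frameSpRat F E σ hσδ hδ hd V b Φ f hΦ₁ hΦ₂ hb hf hT).symm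
  have he₀ : ∀ x : D.spRat, ((e₀ x : (printedDatum F E V Φ ρ i hi).spRat) : adelicSp F E V Φ) =
      (frameSp F E σ hσδ hδ hd V b Φ f hΦ₁ hΦ₂ hb hf).symm.toMonoidHom (x : symplecticGroup (polar (framePairing F d f))) :=
    fun x => by
      rw [MulEquiv.coe_toMonoidHom]
      exact coe_frameSpRat_symm F E σ hσδ hδ hd V b Φ f hΦ₁ hΦ₂ hb hf hT _
  refine SplittingDatum.CompatibleSplitting.transport_of_unique
    (frameSp F E σ hσδ hδ hd V b Φ f hΦ₁ hΦ₂ hb hf).symm.toMonoidHom φ hφ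
    (frameUnitary' F E σ hσδ hδ hd V b Φ f hΦ₁ hΦ₂ hb hf).toMonoidHom
    (continuous_frameUnitary' F E σ hσδ hδ hd V b Φ f hΦ₁ hΦ₂ hb hf hJ) ?_ ?_ ?_ e₀ he₀ ?_ h
  · -- `π' ∘ φ = eSp ∘ π`
    intro m
    rw [printedDatum_proj, MulEquiv.coe_toMonoidHom, MulEquiv.eq_symm_apply]
    exact Subtype.ext (hproj m)
  · -- `ι' = eSp ∘ ι ∘ eG`: the compatibility `adelicToSymplectic ∘ frameUnitary' = frameSp ∘ ι'`
    intro g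
    rw [printedDatum_toSp, MulEquiv.coe_toMonoidHom, MulEquiv.coe_toMonoidHom, MulEquiv.eq_symm_apply,
      ← adelicToSymplectic_frameUnitary']
    exact (Subtype.ext (hDtoSp _)).symm
  · -- `eG (G'(F)) ⊆ G(F)`
    intro γ hγ
    rw [hDrat, MulEquiv.coe_toMonoidHom, frameUnitary'_mem_range_toAdelic_iff]
    rw [printedDatum_ratPts] at hγ
    exact (mem_range_ratUnitaryToAdelic_iff F E V Φ γ).1 hγ
  · -- `i'` is THE rational splitting
    exact printedDatum_ratSplit_unique F E V Φ ρ i hi hi!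

include hi in
/-- **THE PRINTED CONCLUSION FROM THE FRAME**: under the hypotheses of `compatibleSplitting_printedDatum_of_frame`, the
two clauses of [GelbartRogawski1991, Prop. 3.1.1] hold for the printed objects, in the verbatim rendering of
`Prop311AsPrinted`: (1) "*The covering `π` splits over `G(𝐀)`*" and (2) "*There exists a continuous section
`s : G(𝐀) → Mp_𝐀(W)` such that `s(G(F))` is contained in `i(Sp_F(W))`*". [cite: GelbartRogawski1991, Prop. 3.1.1 p. 455 L1–2] -/
theorem printed_conclusion_of_frame
    (hΦ₁ : ∀ (e : E) (x y : V), Φ (e • x) y = e * Φ x y) (hΦ₂ : ∀ (e : E) (x y : V), Φ x (e • y) = Φ x y * σ e)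
    (hb : ∀ i j, i ≠ j → Φ (b i) (b j) = 0) (hf : ∀ i, Φ (b i) (b i) = algebraMap F E (f i) * δ) (hf0 : ∀ i, f i ≠ 0)
    (hi! : ∀ i' : ratSp F E V Φ →* adelicMp F E V Φ ρ, IsRationalSplitting F E V Φ ρ i' → i' = i)
    {J' : Matrix (Fin n) (Fin n) E} (hJ' : J' = (symplecticGram F d f).map (algebraMap F E))
    {T' : Matrix (Fin n) (Fin n) (AdeleRing (𝓞 F) F)}
    (hT'eq : T' = (symplecticGram F d f).map (algebraMap F (AdeleRing (𝓞 F) F))) (hT' : IsUnit T'.det)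
    {Mp : Type*} [Group Mp] [TopologicalSpace Mp]
    (D : SplittingDatum (symplecticGroup (polar (Weil1964.adelicForm F (Fin n) T'))) Mp (UnitaryGroup.adelic F E σ n J'))
    (hDtoSp : ∀ g : UnitaryGroup.adelic F E σ n J',
      ((D.toSp g : symplecticGroup (polar (Weil1964.adelicForm F (Fin n) T'))) :
          ((Fin n → AdeleRing (𝓞 F) F) × (Fin n → AdeleRing (𝓞 F) F)) ≃ₗ[AdeleRing (𝓞 F) F]
            ((Fin n → AdeleRing (𝓞 F) F) × (Fin n → AdeleRing (𝓞 F) F))) =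
        (adelicToSymplectic F E σ n hσδ hδ hd (isSymm_symplecticGram F d f) hJ' g).1)
    (hDrat : D.ratPts = (UnitaryGroup.toAdelic F E σ n J').range)
    (hDsp : D.spRat = (Weil1964.ratSp F T' hT').range)
    (φ : Mp →* adelicMp F E V Φ ρ) (hφ : Continuous φ)
    (hproj : ∀ m : Mp,
      frameConj F E σ hσδ hδ hd V b ((proj F E V Φ ρ (φ m) : adelicSp F E V Φ) :
          AdelicSpace F V ≃ₗ[AdeleRing (𝓞 F) F] AdelicSpace F V) =
        ((D.proj m : symplecticGroup (polar (Weil1964.adelicForm F (Fin n) T'))) :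
          ((Fin n → AdeleRing (𝓞 F) F) × (Fin n → AdeleRing (𝓞 F) F)) ≃ₗ[AdeleRing (𝓞 F) F]
            ((Fin n → AdeleRing (𝓞 F) F) × (Fin n → AdeleRing (𝓞 F) F))))
    (h : D.CompatibleSplitting) :
    (∃ s : adelicUnitary F E V Φ →* adelicMp F E V Φ ρ,
        ∀ g : adelicUnitary F E V Φ,
          projEnd F E V Φ ρ (s g) =
            ((g : AdelicSpace F V ≃ₗ[AdeleRing (𝓞 F) F] AdelicSpace F V) :
              AdelicSpace F V →ₗ[AdeleRing (𝓞 F) F] AdelicSpace F V)) ∧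
      ∃ s : adelicUnitary F E V Φ →* adelicMp F E V Φ ρ,
        Continuous s ∧
        (∀ g : adelicUnitary F E V Φ,
          projEnd F E V Φ ρ (s g) =
            ((g : AdelicSpace F V ≃ₗ[AdeleRing (𝓞 F) F] AdelicSpace F V) :
              AdelicSpace F V →ₗ[AdeleRing (𝓞 F) F] AdelicSpace F V)) ∧
        ∀ g : adelicUnitary F E V Φ,
          IsRationalPoint F E V Φ (g : AdelicSpace F V ≃ₗ[AdeleRing (𝓞 F) F] AdelicSpace F V) → s g ∈ i.range := by
  obtain ⟨s, hsc, hs₁, hs₂⟩ := (compatibleSplitting_printedDatum_iff F E V Φ ρ i hi).1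
    (compatibleSplitting_printedDatum_of_frame F E σ hσδ hδ hd V b Φ f ρ i hi hΦ₁ hΦ₂ hb hf hf0 hi! hJ' hT'eq hT' D hDtoSp
      hDrat hDsp φ hφ hproj h)
  exact ⟨⟨s, hs₁⟩, s, hsc, hs₁, hs₂⟩

end Transport

end Prop311

end Literature.NumberTheory.GelbartRogawski1991

end
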